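import Literature.MathematicalPhysics.QuantumLattice.LiebWuChemicalPotentialDerivative
import Literature.Analysis.FunctionSpaces.LiebWuChargeGapProofs
import HarnessLib

/-!
# Lieb–Wu 1968, eqs. (2), (21), (22): the Bethe-ansatz energy density above half filling by
# hole–particle symmetry, `μ₊ = U − μ₋` as its right derivative at `n = 1`, and the kink `μ₊ > μ₋`

E. H. Lieb, F. Y. Wu, Phys. Rev. Lett. 20 (1968) 1445 (reprint: Montorsi (ed.), *The Hubbard Model*,
World Scientific 1992, pp. 63–68):

> It is then easy to derive the following relations [by considering holes instead of particles in (1)]: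
> `E(M, M′; U) = −(N_a − M − M′)U + E(N_a − M, N_a − M′; U) = …`   (2)   [reprint p. 65]
> `μ₊ ≡ E(M+1, M; U) − E(M, M; U)`, `μ₋ ≡ E(M, M; U) − E(M−1, M; U)`.   (21)
> If `μ₊` and `μ₋` are equal, the system has the property of a conductor. If, on the other hand, we find
> `μ₊ > μ₋`, then the system shares the property of an insulator. … If, however, `N` is exact[ly `N_a`] …
> `μ₊ = U − μ₋` (half-filled band).   (22)   [reprint p. 67]
> It can be established from (22) and (23) that, indeed, `μ₊ > μ₋` for `U > 0`.   [reprint p. 68]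

E. H. Lieb, F. Y. Wu, Physica A 321 (2003) 1, §7 (arXiv:cond-mat/0207529 p. 15):

> In the thermodynamic limit … `E(N) = N_a e(N/N_a)` … It is contained in (energy1) when `N/N_a ≤ 1`.
> A convex function has right and left derivatives at every point and, therefore, `μ₊ =` right
> derivative and `μ₋ =` left derivative are well defined. … But, for `N > N_a` we have to use
> hole–particle symmetry to calculate `E(N)`. … We learn from (energyinvert) that `μ₊ + μ₋ = U`, and
> hence `μ₊ > μ₋` if `μ₋ < U/2`.

In the tree the Bethe-ansatz energy density for `0 < n ≤ 1` is `liebWuEnergyAtFilling U n`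
(`LiebWuEnergyAtFilling`; PRL (17) on the solution of (13)–(15)), `μ₋ = liebWuMuMinus U` is its LEFT
derivative at `n = 1` (`hasDerivWithinAt_liebWuEnergyAtFilling_one`, `LiebWuChemicalPotentialDerivative`),
and `μ₊ − μ₋ = U − 2μ₋ = liebWuChargeGap U > 0` for `U > 0` (`liebWuChargeGap_eq_muMinus`,
`liebWuChargeGap_pos_holds`). This file carries out the printed hole–particle step on that function:

* `liebWuMuPlus U := U − liebWuMuMinus U` — eq. (22); `liebWuMuPlus_sub_liebWuMuMinus`
  (`= liebWuChargeGap U`), `liebWuMuMinus_lt_liebWuMuPlus` (`U > 0`).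
* `liebWuEnergyDensity U n` — the energy density on the whole range `0 < n < 2`: `liebWuEnergyAtFilling U n`
  for `n ≤ 1` and `(n − 1)U + liebWuEnergyAtFilling U (2 − n)` for `n > 1`, i.e. eq. (2) divided by `N_a`
  (`E(N) = −(N_a − N)U + E(2N_a − N)` at `M = M′`); `liebWuEnergyDensity_two_sub`: the symmetry
  `e(2 − n) = (1 − n)U + e(n)` holds for every `n`.
* `hasDerivWithinAt_liebWuEnergyDensity_Iic_one` / `_Ici_one`: for `U > 0`, `μ₋` is the LEFT and
  **`μ₊ = U − μ₋` is the RIGHT derivative of `n ↦ e(n)` at `n = 1`** — eqs. (21)–(22) in the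
  thermodynamic-limit form of Physica A §7.
* `not_differentiableAt_liebWuEnergyDensity_one`: for `U > 0` the energy density is NOT differentiable at
  half filling — the two one-sided derivatives differ by the charge gap `μ₊ − μ₋ = liebWuChargeGap U > 0`
  ("insulator for any nonzero `U`", as a statement about the exact energy function).

HONEST FRAMING: these are theorems about the Bethe-ansatz energy FUNCTION of the integral equations as
printed; its identification with the Hubbard chain's ground-state energy density is Lieb–Wu's announcement
(tree: named fact `lieb_wu`, half filling only) and is not used or asserted here. No named facts; all
statements proved; nothing about the chain Hamiltonian is claimed.

## References

* E. H. Lieb, F. Y. Wu, Phys. Rev. Lett. 20 (1968) 1445, eqs. (2), (21), (22) and the sentence after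
  (23) [LiebWuPRL1968]; reprint pp. 65, 67–68.
* E. H. Lieb, F. Y. Wu, Physica A 321 (2003) 1–27 = arXiv:cond-mat/0207529, §1 eq. (3) (= (energyinvert)),
  §7 p. 15 [LiebWuPhysicaA2003].
-/

noncomputable section

open Set Real Filter
open Literature.Analysis.FunctionSpaces
open scoped Topology

namespace Literature.MathematicalPhysics.QuantumLattice

variable {U n : ℝ}

/-! ### `μ₊ = U − μ₋` (PRL eq. (22)) -/

/-- **Lieb–Wu's chemical potential for ADDING an electron to the half-filled chain**, eq. (22):
`μ₊ = U − μ₋` (half-filled band; from hole–particle symmetry (2), `μ₊ + μ₋ = U`).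
[cite: LiebWuPRL1968, eq. (22)] [cite: LiebWuPhysicaA2003, §7 (μ₊ + μ₋ = U)] -/
def liebWuMuPlus (U : ℝ) : ℝ := U - liebWuMuMinus U

/-- `μ₊ + μ₋ = U`. [cite: LiebWuPhysicaA2003, §7] -/
theorem liebWuMuPlus_add_liebWuMuMinus (U : ℝ) : liebWuMuPlus U + liebWuMuMinus U = U := by
  unfold liebWuMuPlus; ring

/-- `μ₊ − μ₋ = U − 2μ₋ =` the Lieb–Wu charge gap `liebWuChargeGap U`
(`= U − 4 + 8∫₀^∞ J₁(ω)/(ω(1 + e^{ωU/2})) dω`). [cite: LiebWuPRL1968, eqs. (22)–(23)] -/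
theorem liebWuMuPlus_sub_liebWuMuMinus (U : ℝ) :
    liebWuMuPlus U - liebWuMuMinus U = liebWuChargeGap U := by
  rw [liebWuChargeGap_eq_muMinus, liebWuMuPlus]; ring

/-- **"`μ₊ > μ₋` for `U > 0`"** (PRL, sentence after eq. (23)); here from the tree's proof of the
positivity of the charge gap (`liebWuChargeGap_pos_holds`). [cite: LiebWuPRL1968, after eq. (23)] -/
theorem liebWuMuMinus_lt_liebWuMuPlus (hU : 0 < U) : liebWuMuMinus U < liebWuMuPlus U := by
  have h := liebWuChargeGap_pos_holds hU
  rw [← liebWuMuPlus_sub_liebWuMuMinus] at h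
  linarith

/-! ### The energy density on `0 < n < 2` by hole–particle symmetry (PRL eq. (2)) -/

/-- **The Bethe-ansatz ground-state energy density on the whole density range**, extended from
`N ≤ N_a` ("less than half-filled band", PRL (17): `liebWuEnergyAtFilling`) to `N > N_a` by the
hole–particle relation (2), `E(M, M′; U) = −(N_a − N)U + E(N_a − M, N_a − M′; U)`, i.e. per site
`e(n) = (n − 1)U + e(2 − n)` for `n > 1` (Physica A §7: "for `N > N_a` we have to use hole–particle
symmetry to calculate `E(N)`"). [cite: LiebWuPRL1968, eqs. (2), (17)] [cite: LiebWuPhysicaA2003, §7] -/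
def liebWuEnergyDensity (U n : ℝ) : ℝ :=
  if n ≤ 1 then liebWuEnergyAtFilling U n else (n - 1) * U + liebWuEnergyAtFilling U (2 - n)

/-- Below (and at) half filling the energy density is PRL (17) itself. [cite: LiebWuPRL1968, eq. (17)] -/
theorem liebWuEnergyDensity_of_le_one (h : n ≤ 1) :
    liebWuEnergyDensity U n = liebWuEnergyAtFilling U n := by
  simp [liebWuEnergyDensity, h]

/-- Above half filling it is given by hole–particle symmetry. [cite: LiebWuPRL1968, eq. (2)] -/
theorem liebWuEnergyDensity_of_one_lt (h : 1 < n) :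
    liebWuEnergyDensity U n = (n - 1) * U + liebWuEnergyAtFilling U (2 - n) := by
  simp [liebWuEnergyDensity, not_le.2 h]

/-- On `[1, 2)` both descriptions agree (at `n = 1` the correction term vanishes), so the hole–particle
formula holds on the CLOSED right half-line. [cite: LiebWuPRL1968, eq. (2)] -/
theorem liebWuEnergyDensity_of_one_le (h : 1 ≤ n) :
    liebWuEnergyDensity U n = (n - 1) * U + liebWuEnergyAtFilling U (2 - n) := by
  rcases h.eq_or_lt with rfl | h1
  · norm_num [liebWuEnergyDensity]
  · exact liebWuEnergyDensity_of_one_lt h1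

/-- At half filling the energy density is Lieb–Wu's closed form (20), `liebWuEnergy U`.
[cite: LiebWuPRL1968, eq. (20)] -/
theorem liebWuEnergyDensity_one (hU : 0 < U) : liebWuEnergyDensity U 1 = liebWuEnergy U := by
  rw [liebWuEnergyDensity_of_le_one le_rfl, liebWuEnergyAtFilling_one hU]

/-- **Hole–particle symmetry of the energy density, as printed (eq. (2) per site):
`e(2 − n) = (1 − n)·U + e(n)` for every density `n`.** [cite: LiebWuPRL1968, eq. (2)] -/
theorem liebWuEnergyDensity_two_sub (U n : ℝ) :
    liebWuEnergyDensity U (2 - n) = (1 - n) * U + liebWuEnergyDensity U n := by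
  rcases lt_trichotomy n 1 with h | rfl | h
  · rw [liebWuEnergyDensity_of_one_lt (by linarith), liebWuEnergyDensity_of_le_one h.le]
    have : 2 - (2 - n) = n := by ring
    rw [this]; ring
  · norm_num
  · rw [liebWuEnergyDensity_of_le_one (by linarith), liebWuEnergyDensity_of_one_lt h]
    ring

/-! ### One-sided derivatives at half filling: `μ₋` from the left, `μ₊ = U − μ₋` from the right -/

/-- **`μ₋` is the LEFT derivative of the energy density at `n = 1`** (Physica A §7, "`μ₋ =` left
derivative"; eq. (mmu) of the tree, `hasDerivWithinAt_liebWuEnergyAtFilling_one`).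
[cite: LiebWuPhysicaA2003, §7, eq. (mmu)] -/
theorem hasDerivWithinAt_liebWuEnergyDensity_Iic_one (hU : 0 < U) :
    HasDerivWithinAt (liebWuEnergyDensity U) (liebWuMuMinus U) (Iic 1) 1 :=
  (hasDerivWithinAt_liebWuEnergyAtFilling_one hU).congr
    (fun _ hx => liebWuEnergyDensity_of_le_one hx) (liebWuEnergyDensity_of_le_one le_rfl)

/-- **`μ₊ = U − μ₋` is the RIGHT derivative of the energy density at `n = 1`** (PRL eqs. (21)–(22);
Physica A §7, "`μ₊ =` right derivative … `μ₊ + μ₋ = U`"): the chain rule through `n ↦ 2 − n`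
applied to the hole–particle formula. [cite: LiebWuPRL1968, eqs. (21)–(22)]
[cite: LiebWuPhysicaA2003, §7] -/
theorem hasDerivWithinAt_liebWuEnergyDensity_Ici_one (hU : 0 < U) :
    HasDerivWithinAt (liebWuEnergyDensity U) (liebWuMuPlus U) (Ici 1) 1 := by
  -- the reflected function `n ↦ e_{≤1}(2 − n)` has derivative `μ₋ · (−1)` from the right at `1`
  have hrefl : HasDerivWithinAt (fun n : ℝ => 2 - n) (-1) (Ici (1 : ℝ)) 1 := by
    simpa using (hasDerivWithinAt_id (1 : ℝ) (Ici 1)).const_sub 2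
  have hmaps : MapsTo (fun n : ℝ => 2 - n) (Ici (1 : ℝ)) (Iic 1) := fun n hn => by
    simp only [mem_Ici] at hn; simp only [mem_Iic]; linarith
  have hinner : HasDerivWithinAt (liebWuEnergyAtFilling U) (liebWuMuMinus U) (Iic 1) ((fun n : ℝ => 2 - n) 1) := by
    have h21 : (fun n : ℝ => 2 - n) 1 = 1 := by norm_num
    rw [h21]; exact hasDerivWithinAt_liebWuEnergyAtFilling_one hU
  have hcomp : HasDerivWithinAt (liebWuEnergyAtFilling U ∘ fun n : ℝ => 2 - n)
      (liebWuMuMinus U * (-1)) (Ici (1 : ℝ)) 1 := hinner.comp 1 hrefl hmaps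
  -- the affine part `(n − 1)·U`
  have haff : HasDerivWithinAt (fun n : ℝ => (n - 1) * U) U (Ici (1 : ℝ)) 1 := by
    simpa using ((hasDerivWithinAt_id (1 : ℝ) (Ici 1)).sub_const 1).mul_const U
  have hsum := haff.add hcomp
  have hval : U + liebWuMuMinus U * (-1) = liebWuMuPlus U := by unfold liebWuMuPlus; ring
  rw [hval] at hsum
  refine hsum.congr (fun x hx => ?_) ?_
  · simp only [Function.comp, Pi.add_apply]
    exact liebWuEnergyDensity_of_one_le hx
  · simp only [Function.comp, Pi.add_apply]
    exact liebWuEnergyDensity_of_one_le le_rfl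

/-- **The kink at half filling: for `U > 0` the energy density is NOT differentiable at `n = 1`** — its
one-sided derivatives `μ₋ < μ₊` differ by the charge gap `liebWuChargeGap U > 0` ("the ground state for a
half-filled band is insulating for any nonzero `U`"; stated here for the exact Bethe-ansatz energy function,
not for the chain). [cite: LiebWuPRL1968, eqs. (21)–(23) and the sentence after (23)] -/
theorem not_differentiableAt_liebWuEnergyDensity_one (hU : 0 < U) :
    ¬ DifferentiableAt ℝ (liebWuEnergyDensity U) 1 := by
  intro hd
  have hD := hd.hasDerivAt
  have h1 : derivWithin (liebWuEnergyDensity U) (Ici 1) 1 = liebWuMuPlus U :=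
    (hasDerivWithinAt_liebWuEnergyDensity_Ici_one hU).derivWithin (uniqueDiffOn_Ici 1 1 self_mem_Ici)
  have h2 : derivWithin (liebWuEnergyDensity U) (Iic 1) 1 = liebWuMuMinus U :=
    (hasDerivWithinAt_liebWuEnergyDensity_Iic_one hU).derivWithin (uniqueDiffOn_Iic 1 1 self_mem_Iic)
  have h1' : derivWithin (liebWuEnergyDensity U) (Ici 1) 1 = deriv (liebWuEnergyDensity U) 1 :=
    hD.hasDerivWithinAt.derivWithin (uniqueDiffOn_Ici 1 1 self_mem_Ici)
  have h2' : derivWithin (liebWuEnergyDensity U) (Iic 1) 1 = deriv (liebWuEnergyDensity U) 1 :=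
    hD.hasDerivWithinAt.derivWithin (uniqueDiffOn_Iic 1 1 self_mem_Iic)
  have := liebWuMuMinus_lt_liebWuMuPlus hU
  rw [← h1, ← h2, h1', h2'] at this
  exact lt_irrefl _ this

/-- The two one-sided derivatives at half filling differ exactly by the charge gap:
`derivWithin e (Ici 1) 1 − derivWithin e (Iic 1) 1 = μ₊ − μ₋ = liebWuChargeGap U`.
[cite: LiebWuPRL1968, eqs. (21)–(23)] -/
theorem derivWithin_Ici_sub_derivWithin_Iic_liebWuEnergyDensity_one (hU : 0 < U) :
    derivWithin (liebWuEnergyDensity U) (Ici 1) 1 - derivWithin (liebWuEnergyDensity U) (Iic 1) 1 =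
      liebWuChargeGap U := by
  rw [(hasDerivWithinAt_liebWuEnergyDensity_Ici_one hU).derivWithin (uniqueDiffOn_Ici 1 1 self_mem_Ici),
    (hasDerivWithinAt_liebWuEnergyDensity_Iic_one hU).derivWithin (uniqueDiffOn_Iic 1 1 self_mem_Iic),
    liebWuMuPlus_sub_liebWuMuMinus]

/-- Continuity from both sides at half filling (a convex kink, not a jump): the energy density is
continuous at `n = 1` within `Iic 1` and within `Ici 1`, hence at `1`. [cite: LiebWuPhysicaA2003, §7] -/
theorem continuousAt_liebWuEnergyDensity_one (hU : 0 < U) :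
    ContinuousAt (liebWuEnergyDensity U) 1 := by
  have hl := (hasDerivWithinAt_liebWuEnergyDensity_Iic_one hU).continuousWithinAt
  have hr := (hasDerivWithinAt_liebWuEnergyDensity_Ici_one hU).continuousWithinAt
  have : ContinuousWithinAt (liebWuEnergyDensity U) (Iic 1 ∪ Ici 1) 1 := hl.union hr
  rwa [Iic_union_Ici, continuousWithinAt_univ] at this

end Literature.MathematicalPhysics.QuantumLattice

end
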